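import Summits.ResolutionOfSingularities.ResolutionOfSingularities.Theorems.TameTwoStoreyLU2
import HarnessLib

/-!
# TameTwoStoreyLU4 — STEP C of the law `exists_semiInvariant_regularParameters` (joint `T`-eigen regular parameters: eigen brick, Lagrange descent of the unit class in the `K_T`-frame, Nakayama)

One of the landing files of the g29 node «TameTwoStorey» of the ROOT/RESIDUAL decomposition cell `decomp-res` (lens 1,
window (W-α) WHOLE; files `TameTwoStoreyLU`, `…LU1B`, `…LU2` (landed), `…LU3`–`…LU8`); see the module docstring of
`Summits.ResolutionOfSingularities.ResolutionOfSingularities.Theorems.TameTwoStoreyLU` for the thesis, the cell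
`TameOverInertLUAbove k O` (in `…LU2`), the law `relLU_of_tameOverInertLUAbove : TameOverInertLUAbove k O →
RelLocalUniformization k K O` (in `…LU7`), the paper instances and the sources.  This file: STEP C only.
Imports: the landed `…TameTwoStoreyLU2` only.  Problem side, sorry-free, hypothesis-free; every heavy theorem carries
`set_option maxHeartbeats … in` BEFORE its docstring — keep it.
-/

noncomputable section

open IsLocalRing Polynomial IntermediateField Literature.AlgebraicGeometry.Resolution
open Summit.ResolutionOfSingularities.ResolutionOfSingularities.Theorems.TameQuotientLU
open Summit.ResolutionOfSingularities.ResolutionOfSingularities.Theorems.TameAbelianQuotientLU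
open Summit.ResolutionOfSingularities.ResolutionOfSingularities.Theorems.InertiaIsotypicStability
open Summit.ResolutionOfSingularities.ResolutionOfSingularities.Theorems.TameInertialLU
open Summit.ResolutionOfSingularities.ResolutionOfSingularities.Theorems.TameAbelianMonomialChart

namespace Summit.ResolutionOfSingularities.ResolutionOfSingularities.Theorems.TameTwoStoreyLU

universe u

section Law

variable (k : Type) [Field k] {K : Type} [Field K] [Algebra k K]

variable {k}

set_option maxHeartbeats 2000000 in
/-- **STEP C of the two-storey law — jointly `T`-EIGEN parameters and LAGRANGE DESCENT ALONG `H` IN THE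
`K_T`-FRAME ⇒ a SEMI-INVARIANT regular system of parameters.**  Frame: `τ 0, …, τ (r-1)` enumerate the (tame,
abelian, exponent-`e`) inertia automorphisms, `K_T` is their fixed field, `M ⊆ O′` a `G`-stable model with
`B := locAtCentre M O′` regular of dimension `d`, containing `ζ`, the separator `x_s ∈ K_T` and, for every
character `c` occurring on `O′`, a `T`-eigenvector `f_c` together with all twisting quotients `g f_c / g′ f_c`
(`T`-fixed by isotypic stability); `H′ = G|_{K_T}` with fixed field `K₀` (`exists_galFrame`) and `x_s` separates
`H′`.  Then `𝔪_B` has a regular system of parameters `u_j` with `τ_i u_j = ζ^{s′ i j} u_j` and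
`g u_j = ε_{g,j} u_j`, `ε_{g,j}^{±1} ∈ M ∩ K_T`: the eigen-parameters `x_j`
(`exists_joint_eigen_regularParameters_of_commuting`) have `K_T`-coordinates `x_j / f_{c_j}` in the `H′`-stable
`locAtCentre (M ∩ K_T) (O′ ∩ K_T)`-modules `N_j = {n | f_{c_j} n ∈ 𝔪_B}` (stability BY THE TWIST), Lagrange
descent `InvariantDescentLU.exists_sum_fixed_of_stable` makes the coordinates `G`-fixed, and Nakayama
(`exists_fin_of_span_eq_maximalIdeal`) extracts the system among the semi-invariants `f_{c_j} · m`.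
[cite: CossartPiltant2008, Lemma 9.4] [folklore: Lagrange resolvents] -/
theorem exists_semiInvariant_regularParameters {K' : Type} [Field K'] [Algebra K K']
    {O' : ValuationSubring K'} (hgv : ∀ (g : K' ≃ₐ[K] K') (y : K'), O'.valuation (g y) = O'.valuation y)
    {e : ℕ} (he : 0 < e) (hve : O'.valuation (e : K') = 1)
    (τ : ℕ → K' ≃+* K') (r : ℕ) (hτapp : ∀ i < r, ∃ g : K' ≃ₐ[K] K', ∀ z, τ i z = g z)
    (hτe : ∀ i < r, τ i ^ e = 1) (hcomm : ∀ i < r, ∀ i' < r, ∀ z : K', τ i (τ i' z) = τ i' (τ i z))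
    {ζ : K'} (hζe : ζ ^ e = 1) (hζ0 : ζ ≠ 0) (hτζ : ∀ i < r, τ i ζ = ζ)
    (hvη : ∀ j : ℕ, 0 < j → j < e → O'.valuation (ζ ^ j - 1) = 1)
    (KT : Subfield K') (hKT : ∀ z : K', z ∈ KT ↔ ∀ i < r, τ i z = z)
    {M : Subring K'} (hMO : M ≤ O'.toSubring) (hGM : ∀ (g : K' ≃ₐ[K] K'), ∀ y ∈ M, g y ∈ M)
    (hζM : ζ ∈ M) {xs : K'} (hxsKT : xs ∈ KT) (hxsM : xs ∈ M)
    (hBreg : IsRegularLocalRing (locAtCentre M O'))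
    {d : ℕ} (hBdim : ringKrullDim (locAtCentre M O') = (d : ℕ))
    (fc : (Fin r → Fin e) → K') (hfc0 : ∀ c, fc c ≠ 0) (hfcM : ∀ c, fc c ∈ M)
    (hfcP : ∀ c : Fin r → Fin e, (∃ f : K', f ≠ 0 ∧ f ∈ O' ∧
        ∀ i (hi : i < r), τ i f = ζ ^ ((c ⟨i, hi⟩ : Fin e) : ℕ) * f) →
      ∀ i (hi : i < r), τ i (fc c) = ζ ^ ((c ⟨i, hi⟩ : Fin e) : ℕ) * fc c)
    (hgeig : ∀ c : Fin r → Fin e, (∃ f : K', f ≠ 0 ∧ f ∈ O' ∧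
        ∀ i (hi : i < r), τ i f = ζ ^ ((c ⟨i, hi⟩ : Fin e) : ℕ) * f) →
      ∀ (g : K' ≃ₐ[K] K') (i : ℕ) (hi : i < r), τ i (g (fc c)) = ζ ^ ((c ⟨i, hi⟩ : Fin e) : ℕ) * g (fc c))
    (hquotM : ∀ (c : Fin r → Fin e) (g g' : K' ≃ₐ[K] K'), g (fc c) / g' (fc c) ∈ M)
    (hquotT : ∀ (c : Fin r → Fin e) (g g' : K' ≃ₐ[K] K'), g (fc c) / g' (fc c) ∈ KT)
    (H' : Finset (KT ≃+* KT)) (K₀ : Subfield KT) (h1H : (1 : KT ≃+* KT) ∈ H')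
    (hmulH : ∀ a ∈ H', ∀ b ∈ H', a * b ∈ H') (hK : ∀ w : KT, w ∈ K₀ ↔ ∀ h ∈ H', h w = w)
    (hK₀ : ∀ w : KT, w ∈ K₀ ↔ ∀ g : K' ≃ₐ[K] K', g (w : K') = w)
    (hHO : ∀ h ∈ H', ∀ w : KT, w ∈ O'.comap KT.subtype ↔ h w ∈ O'.comap KT.subtype)
    (hH'G : ∀ h ∈ H', ∃ g : K' ≃ₐ[K] K', ∀ w : KT, ((h w : KT) : K') = g w)
    (hsepE : ∀ h ∈ H', h ≠ 1 →
      (O'.comap KT.subtype).valuation ((⟨xs, hxsKT⟩ : KT) - h ⟨xs, hxsKT⟩) = 1) :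
    ∃ (u : Fin d → locAtCentre M O') (s' : ℕ → Fin d → ℕ) (ε : (K' ≃ₐ[K] K') → Fin d → K'),
      Ideal.span (Set.range u) = maximalIdeal (locAtCentre M O') ∧
      (∀ j, ((u j : locAtCentre M O') : K') ≠ 0) ∧
      (∀ i < r, ∀ j, τ i (u j) = ζ ^ s' i j * u j) ∧
      (∀ (g : K' ≃ₐ[K] K') (j), g (u j) = ε g j * u j) ∧
      (∀ (g : K' ≃ₐ[K] K') (j), ε g j ∈ M ∧ (ε g j)⁻¹ ∈ M) ∧
      (∀ (g : K' ≃ₐ[K] K') (j), ε g j ∈ KT ∧ (ε g j)⁻¹ ∈ KT) := by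
  classical
  have he0 : e ≠ 0 := he.ne'
  have hgm : ∀ (g : K' ≃ₐ[K] K') (y : K'), O'.valuation y < 1 → O'.valuation (g y) < 1 :=
    fun g y hy => by rw [hgv]; exact hy
  set B : Subring K' := locAtCentre M O' with hBdef
  haveI := hBreg
  have hBO : B ≤ O'.toSubring := locAtCentre_le hMO
  have hMB : M ≤ B := le_locAtCentre M O'
  have hdomB : ∀ b : B, b ∈ maximalIdeal B ↔ O'.valuation (b : K') < 1 :=
    mem_maximalIdeal_locAtCentre_iff hMO
  have hunitB : ∀ b : B, O'.valuation (b : K') = 1 → IsUnit b := by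
    intro b hb
    by_contra hnu
    have h1 : b ∈ maximalIdeal B := (IsLocalRing.mem_maximalIdeal b).mpr (mem_nonunits_iff.mpr hnu)
    exact absurd hb (ne_of_lt ((hdomB b).mp h1))
  have hgB : ∀ (g : K' ≃ₐ[K] K'), ∀ b ∈ B, g b ∈ B := by
    intro g b hb
    obtain ⟨y, hy, s, hs, hsv, rfl⟩ := mem_locAtCentre_iff.mp hb
    exact mem_locAtCentre_iff.mpr ⟨g y, hGM g y hy, g s, hGM g s hs, by rw [hgv]; exact hsv,
      map_div₀ g y s⟩
  have hτB : ∀ i < r, ∀ b ∈ B, τ i b ∈ B := by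
    intro i hi b hb
    obtain ⟨g, hg⟩ := hτapp i hi
    rw [hg b]
    exact hgB g b hb
  -- hypotheses of the eigen-parameter brick on `B`
  have heuB : IsUnit ((e : B)) := hunitB _ (by push_cast; exact hve)
  have hζB : ζ ∈ B := hMB hζM
  have hζuB : ∀ j : ℕ, 0 < j → j < e → IsUnit ((⟨ζ, hζB⟩ : B) ^ j - 1) := fun j hj hje =>
    hunitB _ (by push_cast; exact hvη j hj hje)
  have hτsymm : ∀ i < r, ∀ b : K', (τ i).symm b = (τ i ^ (e - 1)) b := fun i hi b => by
    rw [RingEquiv.symm_apply_eq]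
    change b = (τ i * τ i ^ (e - 1)) b
    rw [← pow_succ', Nat.sub_add_cancel he, hτe i hi]
    rfl
  have hτpowB : ∀ i < r, ∀ (n : ℕ) (b : K'), b ∈ B → (τ i ^ n) b ∈ B := by
    intro i hi n
    induction n with
    | zero => intro b hb; exact hb
    | succ n ih => intro b hb; rw [pow_succ', RingAut.mul_apply]; exact hτB i hi _ (ih b hb)
  have hτB' : ∀ i < r, ∀ b ∈ B, (τ i).symm b ∈ B := fun i hi b hb => by
    rw [hτsymm i hi]; exact hτpowB i hi _ b hb
  let τB : ℕ → B ≃+* B := fun i =>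
    if hi : i < r then restrictAut (τ i) B (hτB i hi) (hτB' i hi) else RingEquiv.refl B
  have hτB_apply : ∀ i < r, ∀ b : B, ((τB i b : B) : K') = τ i b := fun i hi b => by
    simp only [τB, dif_pos hi, restrictAut_apply]
  have hτBpow : ∀ i < r, ∀ (n : ℕ) (b : B), (((τB i ^ n) b : B) : K') = (τ i ^ n) (b : K') := by
    intro i hi n
    induction n with
    | zero => intro b; rfl
    | succ n ih =>
      intro b; rw [pow_succ', RingAut.mul_apply, pow_succ', RingAut.mul_apply, hτB_apply i hi, ih]
  have hτBe : ∀ i < r, τB i ^ e = 1 := fun i hi =>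
    RingEquiv.ext fun b => Subtype.ext (by rw [hτBpow i hi, hτe i hi]; rfl)
  have hcommB : ∀ i < r, ∀ i' < r, ∀ b : B, τB i (τB i' b) = τB i' (τB i b) := by
    intro i hi i' hi' b
    apply Subtype.ext
    simp only [hτB_apply i hi, hτB_apply i' hi']
    exact hcomm i hi i' hi' _
  have hτζB : ∀ i < r, τB i ⟨ζ, hζB⟩ = ⟨ζ, hζB⟩ := fun i hi =>
    Subtype.ext (by rw [hτB_apply i hi]; exact hτζ i hi)
  have hζBe : (⟨ζ, hζB⟩ : B) ^ e = 1 := Subtype.ext (by push_cast; exact hζe)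
  -- joint `T`-eigen-parameters of `B` …
  obtain ⟨xp, s, hspan, hsx⟩ :=
    exists_joint_eigen_regularParameters_of_commuting τB r he0 hτBe hcommB heuB ⟨ζ, hζB⟩ hτζB hζBe
      hζuB hBdim
  let xF : Fin d → K' := fun j => ((xp j : B) : K')
  have hxB : ∀ j, xF j ∈ B := fun j => (xp j).2
  have hτx : ∀ i < r, ∀ j, τ i (xF j) = ζ ^ s i j * xF j := fun i hi j => by
    have h := congrArg (fun b : B => (b : K')) (hsx i hi j).2
    simpa [hτB_apply i hi, xF] using h
  have hx0 : ∀ j, xF j ≠ 0 := fun j h0 =>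
    ne_zero_of_span_eq_maximalIdeal hBdim xp hspan j (Subtype.ext h0)
  have hxm : ∀ j, O'.valuation (xF j) < 1 := fun j =>
    (hdomB (xp j)).mp (hspan ▸ Ideal.subset_span ⟨j, rfl⟩)
  -- … their characters occur, so `f j := f_{c j}` is an eigenvector of the same character in `M`
  let cχ : Fin d → Fin r → Fin e := fun j i => ⟨s i j, (hsx i i.2 j).1⟩
  have hPc : ∀ j, ∃ f : K', f ≠ 0 ∧ f ∈ O' ∧
      ∀ i (hi : i < r), τ i f = ζ ^ ((cχ j ⟨i, hi⟩ : Fin e) : ℕ) * f :=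
    fun j => ⟨xF j, hx0 j, hBO (hxB j), fun i hi => hτx i hi j⟩
  let f : Fin d → K' := fun j => fc (cχ j)
  have hf0 : ∀ j, f j ≠ 0 := fun j => hfc0 _
  have hfeig : ∀ i < r, ∀ j, τ i (f j) = ζ ^ s i j * f j := fun i hi j => hfcP _ (hPc j) i hi
  have hfB : ∀ j, f j ∈ B := fun j => hMB (hfcM _)
  have hgfeig : ∀ (g : K' ≃ₐ[K] K') (i : ℕ), i < r → ∀ j, τ i (g (f j)) = ζ ^ s i j * g (f j) :=
    fun g i hi j => hgeig _ (hPc j) g i hi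
  have hεB : ∀ (g g' : K' ≃ₐ[K] K') (j), g (f j) / g' (f j) ∈ B := fun g g' j => hMB (hquotM _ g g')
  have hεKT : ∀ (g g' : K' ≃ₐ[K] K') (j), g (f j) / g' (f j) ∈ KT := fun g g' j => hquotT _ g g'
  have hquotv : ∀ (g g' : K' ≃ₐ[K] K') (j), O'.valuation (g (f j) / g' (f j)) = 1 := by
    intro g g' j
    rw [map_div₀, hgv, hgv, div_self]
    exact (Valuation.ne_zero_iff _).mpr (hf0 j)
  -- the frame: `O′ ∩ K_T`, the model `M ∩ K_T`, the separator read in `K_T`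
  let OE' : ValuationSubring KT := O'.comap KT.subtype
  have hOE' : ∀ w : KT, w ∈ OE' ↔ (w : K') ∈ O' := fun w => StableRestrict.mem_comap_subtype_iff O' KT w
  let TM : Subring KT := M.comap KT.subtype
  have hTM : ∀ w : KT, w ∈ TM ↔ (w : K') ∈ M := fun w => Subring.mem_comap
  have hTMH : ∀ h ∈ H', ∀ w ∈ TM, h w ∈ TM := by
    intro h hh w hw
    obtain ⟨g, hg⟩ := hH'G h hh
    rw [hTM, hg]
    exact hGM g _ ((hTM w).mp hw)
  let xE : KT := ⟨xs, hxsKT⟩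
  have hxTM : xE ∈ TM := (hTM xE).mpr hxsM
  have hC'B : ∀ c ∈ locAtCentre TM OE', (c : K') ∈ B := by
    intro c hc
    have h1 : KT.subtype c ∈ (locAtCentre TM OE').map KT.subtype := Subring.mem_map.mpr ⟨c, hc, rfl⟩
    rw [StableRestrict.map_locAtCentre_comap O' KT TM] at h1
    refine locAtCentre_mono O' ?_ h1
    intro w hw
    obtain ⟨c', hc', rfl⟩ := Subring.mem_map.mp hw
    exact (hTM c').mp hc'
  -- the `H`-stable `C`-modules `N j = {n ∈ K_T | f j · n ∈ 𝔪_B}`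
  let N : Fin d → AddSubgroup KT := fun j =>
    { carrier := {n | f j * (n : K') ∈ B ∧ O'.valuation (f j * (n : K')) < 1}
      zero_mem' := by
        refine ⟨?_, ?_⟩
        · rw [ZeroMemClass.coe_zero, mul_zero]; exact B.zero_mem
        · rw [ZeroMemClass.coe_zero, mul_zero, map_zero]; exact zero_lt_one
      add_mem' := by
        rintro a b ⟨haB, hav⟩ ⟨hbB, hbv⟩
        refine ⟨?_, ?_⟩
        · rw [AddMemClass.coe_add, mul_add]; exact B.add_mem haB hbB
        · rw [AddMemClass.coe_add, mul_add]
          exact lt_of_le_of_lt (Valuation.map_add _ _ _) (max_lt hav hbv)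
      neg_mem' := by
        rintro a ⟨haB, hav⟩
        refine ⟨?_, ?_⟩
        · rw [NegMemClass.coe_neg, mul_neg]; exact B.neg_mem haB
        · rw [NegMemClass.coe_neg, mul_neg, Valuation.map_neg]; exact hav }
  have hN : ∀ (j) (n : KT), n ∈ N j ↔ f j * (n : K') ∈ B ∧ O'.valuation (f j * (n : K')) < 1 :=
    fun j n => Iff.rfl
  have hNC : ∀ j, ∀ c ∈ locAtCentre TM OE', ∀ n ∈ N j, c * n ∈ N j := by
    intro j c hc n hn
    rw [hN] at hn ⊢
    have hcB := hC'B c hc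
    have hc1 : O'.valuation (c : K') ≤ 1 := (O'.valuation_le_one_iff _).mpr (hBO hcB)
    have h1 : f j * ((c * n : KT) : K') = (c : K') * (f j * (n : K')) := by
      rw [MulMemClass.coe_mul]; ring
    rw [h1]
    refine ⟨B.mul_mem hcB hn.1, ?_⟩
    rw [map_mul]
    calc O'.valuation (c : K') * O'.valuation (f j * (n : K'))
        ≤ 1 * O'.valuation (f j * (n : K')) := mul_le_mul' hc1 le_rfl
      _ < 1 := by rw [one_mul]; exact hn.2
  have hNH : ∀ j, ∀ h ∈ H', ∀ n ∈ N j, h n ∈ N j := by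
    intro j h hh n hn
    obtain ⟨g, hg⟩ := hH'G h hh
    rw [hN] at hn ⊢
    rw [hg]
    have hgf0 : g (f j) ≠ 0 := (map_ne_zero_iff (g : K' ≃ₐ[K] K') g.injective).mpr (hf0 j)
    have hid : f j * g (n : K') = g (f j * (n : K')) * (f j / g (f j)) := by
      rw [map_mul, mul_comm (g (f j)) _, mul_assoc, mul_div_cancel₀ _ hgf0, mul_comm]
    rw [hid]
    have hq1 : O'.valuation (f j / g (f j)) = 1 := by
      have h := hquotv 1 g j
      rwa [AlgEquiv.one_apply] at h
    have hqB : f j / g (f j) ∈ B := by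
      have h := hεB 1 g j
      rwa [AlgEquiv.one_apply] at h
    refine ⟨B.mul_mem (hgB g _ hn.1) hqB, ?_⟩
    rw [map_mul, hq1, mul_one]
    exact hgm g _ hn.2
  -- the coordinates `x j / f j ∈ N j` and their Lagrange descent
  have hnKT : ∀ j, xF j / f j ∈ KT := fun j => (hKT _).mpr fun i hi => by
    rw [map_div₀, hτx i hi j, hfeig i hi j, mul_div_mul_left _ _ (pow_ne_zero _ hζ0)]
  let nn : Fin d → KT := fun j => ⟨xF j / f j, hnKT j⟩
  have hfnn : ∀ j, f j * (nn j : K') = xF j := fun j => mul_div_cancel₀ _ (hf0 j)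
  have hnN : ∀ j, nn j ∈ N j := fun j => by
    rw [hN, hfnn]
    exact ⟨hxB j, hxm j⟩
  have hcoord : ∀ j, ∃ (kk : ℕ) (a m : ℕ → KT),
      (∀ i, a i ∈ locAtCentre TM OE' ∧ m i ∈ N j ∧ m i ∈ K₀) ∧
        nn j = ∑ i ∈ Finset.range kk, a i * m i := fun j =>
    InvariantDescentLU.exists_sum_fixed_of_stable OE' h1H hmulH hK hHO hTMH hxTM hsepE (N j) (hNC j)
      (hNH j) (hnN j)
  -- `𝔪_B` is generated by SEMI-INVARIANT elements `f j · m`, `m` `G`-fixed; extract an r.s.p. among them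
  let U : Set B := {w | w ∈ maximalIdeal B ∧
    ∃ j, ∃ m : K', (∀ g : K' ≃ₐ[K] K', g m = m) ∧ (w : K') = f j * m}
  have hUm : U ⊆ (maximalIdeal B : Set B) := fun w hw => hw.1
  have hxU : ∀ j, xp j ∈ Ideal.span U := by
    intro j
    obtain ⟨kk, a, m, ham, hsum⟩ := hcoord j
    have hxeq : xp j = ∑ i ∈ Finset.range kk,
        (⟨(a i : K'), hC'B _ (ham i).1⟩ : B) * ⟨f j * (m i : K'), ((hN j (m i)).mp (ham i).2.1).1⟩ := by
      apply Subtype.ext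
      have h1 : ((xp j : B) : K') = f j * (nn j : K') := (hfnn j).symm
      rw [h1, hsum]
      push_cast
      rw [Finset.mul_sum]
      exact Finset.sum_congr rfl fun i _ => by ring
    rw [hxeq]
    refine Ideal.sum_mem _ fun i _ => Ideal.mul_mem_left _ _ (Ideal.subset_span ⟨?_, j, m i, ?_, rfl⟩)
    · exact (hdomB _).mpr ((hN j (m i)).mp (ham i).2.1).2
    · exact (hK₀ (m i)).mp (ham i).2.2
  have hspanU : Ideal.span U = maximalIdeal B :=
    le_antisymm (Ideal.span_le.mpr hUm) (by
      rw [← hspan]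
      refine Ideal.span_le.mpr ?_
      rintro _ ⟨j, rfl⟩
      exact hxU j)
  obtain ⟨u, huU, huspan⟩ := exists_fin_of_span_eq_maximalIdeal hBdim U hUm hspanU
  have huU' : ∀ j, ∃ j', ∃ m : K', (∀ g : K' ≃ₐ[K] K', g m = m) ∧ ((u j : B) : K') = f j' * m :=
    fun j => (huU j).2
  choose jj mm hmmG hu using huU'
  have hu0 : ∀ j, ((u j : B) : K') ≠ 0 := fun j h0 =>
    ne_zero_of_span_eq_maximalIdeal hBdim u huspan j (Subtype.ext h0)
  have hmmKT : ∀ j, mm j ∈ KT := fun j => (hKT _).mpr fun i hi => by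
    obtain ⟨g, hg⟩ := hτapp i hi
    rw [hg]
    exact hmmG j g
  refine ⟨u, fun i j => s i (jj j), fun g j => g (f (jj j)) / f (jj j), huspan, hu0, ?_, ?_, ?_, ?_⟩
  · intro i hi j
    rw [hu j, map_mul, hfeig i hi (jj j), (hKT (mm j)).mp (hmmKT j) i hi, mul_assoc]
  · intro g j
    rw [hu j, map_mul, hmmG j g, div_mul_eq_mul_div, eq_div_iff (hf0 _)]
    ring
  · intro g j
    refine ⟨?_, ?_⟩
    · have h := hquotM (cχ (jj j)) g 1
      rwa [AlgEquiv.one_apply] at h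
    · have h := hquotM (cχ (jj j)) 1 g
      rwa [AlgEquiv.one_apply, ← inv_div] at h
  · intro g j
    have h := hεKT g 1 (jj j)
    rw [AlgEquiv.one_apply] at h
    exact ⟨h, KT.inv_mem h⟩

end Law

end Summit.ResolutionOfSingularities.ResolutionOfSingularities.Theorems.TameTwoStoreyLU

end
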